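import Mathlib
import Summits.RiemannHypothesis.RiemannHypothesis.Theorems.ScrewManifestAtomSumBounds
import HarnessLib

/-!
# RH-FREE toolbox for the corner gap (L2 of `ScrewManifestCornerGap`): mass control and the second difference

Ingredients (i) and (ii′) of the explicit proof of `Manifest.CornerGap` (no compactness in function space):

* `exists_anchor_lower_bound` : for every band limit `θ > 0` there are `κ > 0` and an anchor `x₁ ∈ [2, 3]`
  with `κ ≤ (1 − cos 2τ)/τ² + (1 − cos(x₁τ))/τ²` for all `0 < τ ≤ θ` (Jordan's inequality below `π/3`,
  a positive minimum of a continuous function on `[π/3, θ]` above);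
* `sum_weights_le_of_nearMiss` : MASS CONTROL — if a nonnegative atom sum `Φ(s) = Σ_k W_k(1 − cos(τ_k s))/τ_k²`
  with `0 < τ_k ≤ θ` is within `ε ≤ 1` of `s/2` on a `δ`-dense subset `P ⊆ [1, 3]`, `δ ≤ κ/16`, then
  `Σ_k W_k ≤ 8/κ` (evaluate near the two anchors; equicontinuity `abs_cosAtomSum_sub_le`);
* `cosAtomSum_second_diff` : the EXACT second difference
  `Φ(s+h) − 2Φ(s) + Φ(s−h) = h²·Σ_k W_k·(2(1 − cos(τ_k h))/(τ_k h)²)·cos(τ_k s)` (it kills `s/2`);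
* `three_quarters_le_sincSq` : `3/4 ≤ 2(1 − cos x)/x²` for `0 < x ≤ 1`;
* `one_sub_le_sum_weights` : `|Φ(1) − 1/2| ≤ t ⇒ 1 − 2t ≤ Σ_k W_k`.

RH-FREE elementary analysis; nothing here bears on the truth of RH.  References: [folklore].
-/

set_option linter.dupNamespace false
set_option autoImplicit false

noncomputable section

open Real Set Finset

namespace Summit.RiemannHypothesis.RiemannHypothesis.Theorems.IntegerScrew.Manifest

/-- Jordan below `π/3`: for `0 < τ ≤ π/3`, `4/5 ≤ (1 − cos 2τ)/τ²`. [folklore] -/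
theorem four_fifths_le_cosAtom_two {τ : ℝ} (hτ0 : 0 < τ) (hτ1 : τ ≤ π / 3) :
    4 / 5 ≤ (1 - Real.cos (τ * 2)) / τ ^ 2 := by
  have hpi := Real.pi_gt_three
  have hpi' := Real.pi_lt_d2
  have h1 : 1 - Real.cos (τ * 2) = 2 * Real.sin τ ^ 2 := by
    rw [mul_comm, Real.cos_two_mul, Real.cos_sq']; ring
  have h2 : 2 / π * τ ≤ Real.sin τ := Real.mul_le_sin hτ0.le (by linarith)
  have h3 : 0 ≤ 2 / π * τ := by positivity
  have h4 : (2 / π * τ) ^ 2 ≤ Real.sin τ ^ 2 := pow_le_pow_left₀ h3 h2 2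
  rw [h1, le_div_iff₀ (by positivity)]
  have h5 : (2 / π * τ) ^ 2 = 4 * τ ^ 2 / π ^ 2 := by ring
  have h6 : 4 * τ ^ 2 / π ^ 2 ≥ 4 * τ ^ 2 / 10 := by
    apply div_le_div_of_nonneg_left (by positivity) (by positivity)
    nlinarith
  nlinarith

/-- **Anchors.** For every `θ > 0` there are `κ > 0` and `x₁ ∈ [2, 3]` with
`κ ≤ (1 − cos 2τ)/τ² + (1 − cos(x₁ τ))/τ²` for all `0 < τ ≤ θ`. [folklore] -/
theorem exists_anchor_lower_bound {θ : ℝ} (hθ : 0 < θ) :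
    ∃ κ x₁ : ℝ, 0 < κ ∧ 2 ≤ x₁ ∧ x₁ ≤ 3 ∧ ∀ τ : ℝ, 0 < τ → τ ≤ θ →
      κ ≤ (1 - Real.cos (τ * 2)) / τ ^ 2 + (1 - Real.cos (τ * x₁)) / τ ^ 2 := by
  have hpi := Real.pi_gt_three
  -- the anchor `x₁ = 2 + 1/N`, `N = ⌈θ⌉₊ + 1 > θ`
  set N : ℕ := ⌈θ⌉₊ + 1 with hN
  have hN1 : (1 : ℝ) ≤ N := by
    rw [hN]; push_cast; linarith [Nat.cast_nonneg (α := ℝ) ⌈θ⌉₊]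
  have hNθ : θ < N := by
    rw [hN]; push_cast; linarith [Nat.le_ceil θ]
  have hN0 : (0 : ℝ) < N := by linarith
  set x₁ : ℝ := 2 + 1 / N with hx₁
  have hx₁2 : 2 ≤ x₁ := by
    rw [hx₁]; have : 0 ≤ 1 / (N : ℝ) := (by positivity); linarith
  have hx₁3 : x₁ ≤ 3 := by
    rw [hx₁]; have : 1 / (N : ℝ) ≤ 1 := by rw [div_le_one hN0]; exact hN1
    linarith
  -- the function and its positivity on `[π/3, θ']`
  set θ' : ℝ := max θ (π / 3) with hθ'
  set F : ℝ → ℝ := fun τ => (1 - Real.cos (τ * 2)) / τ ^ 2 + (1 - Real.cos (τ * x₁)) / τ ^ 2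
    with hF
  have hFcont : ContinuousOn F (Icc (π / 3) θ') := by
    have hne : ∀ τ ∈ Icc (π / 3) θ', τ ^ 2 ≠ 0 := by
      intro τ hτ; have : 0 < τ := by linarith [hτ.1]
      positivity
    apply ContinuousOn.add
    · exact ContinuousOn.div (by fun_prop) (by fun_prop) hne
    · exact ContinuousOn.div (by fun_prop) (by fun_prop) hne
  have hFpos : ∀ τ ∈ Icc (π / 3) θ', 0 < F τ := by
    intro τ hτ
    have hτ0 : 0 < τ := by linarith [hτ.1]
    have hτN : τ / N < 2 * π := by
      have h1 : τ ≤ θ' := hτ.2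
      have h2 : τ / N ≤ τ := by
        rw [div_le_iff₀ hN0]; nlinarith
      -- `τ ≤ θ' = max θ (π/3)`; in either case `τ/N < 2π`
      rcases le_max_iff.mp (le_of_eq hθ'.symm : θ' ≤ max θ (π / 3)) with hh | hh
      · have : τ / N < 1 := by
          rw [div_lt_one hN0]; linarith
        linarith
      · have : τ ≤ π / 3 := le_trans h1 hh
        linarith
    have hA : 0 ≤ (1 - Real.cos (τ * 2)) / τ ^ 2 := cosAtom_nonneg τ 2
    have hB : 0 ≤ (1 - Real.cos (τ * x₁)) / τ ^ 2 := cosAtom_nonneg τ x₁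
    by_contra hle
    push Not at hle
    have hA0 : (1 - Real.cos (τ * 2)) / τ ^ 2 = 0 := by
      have : F τ = (1 - Real.cos (τ * 2)) / τ ^ 2 + (1 - Real.cos (τ * x₁)) / τ ^ 2 := rfl
      linarith
    have hB0 : (1 - Real.cos (τ * x₁)) / τ ^ 2 = 0 := by
      have : F τ = (1 - Real.cos (τ * 2)) / τ ^ 2 + (1 - Real.cos (τ * x₁)) / τ ^ 2 := rfl
      linarith
    have hτ2 : τ ^ 2 ≠ 0 := by positivity
    have hcA : Real.cos (τ * 2) = 1 := by
      rcases div_eq_zero_iff.mp hA0 with h | h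
      · linarith
      · exact absurd h hτ2
    have hcB : Real.cos (τ * x₁) = 1 := by
      rcases div_eq_zero_iff.mp hB0 with h | h
      · linarith
      · exact absurd h hτ2
    obtain ⟨a, ha⟩ := (Real.cos_eq_one_iff _).mp hcA
    obtain ⟨b, hb⟩ := (Real.cos_eq_one_iff _).mp hcB
    -- `τ/N = (b − a)·2π` with `0 < τ/N < 2π`
    have hdiff : ((b - a : ℤ) : ℝ) * (2 * π) = τ / N := by
      push_cast
      have e : τ * x₁ = τ * 2 + τ / N := by rw [hx₁]; ring
      rw [sub_mul, hb, ha, e]; ring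
    have hpos : (0 : ℝ) < ((b - a : ℤ) : ℝ) := by
      have : 0 < τ / N := by positivity
      nlinarith
    have hlt : ((b - a : ℤ) : ℝ) < 1 := by nlinarith
    have h1 : (0 : ℤ) < b - a := by exact_mod_cast hpos
    have h2 : b - a < (1 : ℤ) := by exact_mod_cast hlt
    omega
  -- minimum on the compact interval
  have hne : (Icc (π / 3) θ').Nonempty := ⟨π / 3, le_rfl, le_max_right _ _⟩
  obtain ⟨τ₀, hτ₀, hmin⟩ := (isCompact_Icc : IsCompact (Icc (π / 3) θ')).exists_isMinOn hne hFcont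
  have hκ₂ : 0 < F τ₀ := hFpos τ₀ hτ₀
  refine ⟨min (4 / 5) (F τ₀), x₁, lt_min (by norm_num) hκ₂, hx₁2, hx₁3, fun τ hτ0 hτθ => ?_⟩
  by_cases hsmall : τ ≤ π / 3
  · calc min (4 / 5) (F τ₀) ≤ 4 / 5 := min_le_left _ _
      _ ≤ (1 - Real.cos (τ * 2)) / τ ^ 2 := four_fifths_le_cosAtom_two hτ0 hsmall
      _ ≤ (1 - Real.cos (τ * 2)) / τ ^ 2 + (1 - Real.cos (τ * x₁)) / τ ^ 2 :=
          le_add_of_nonneg_right (cosAtom_nonneg τ x₁)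
  · push Not at hsmall
    have hmem : τ ∈ Icc (π / 3) θ' := ⟨hsmall.le, le_trans hτθ (le_max_left _ _)⟩
    calc min (4 / 5) (F τ₀) ≤ F τ₀ := min_le_right _ _
      _ ≤ F τ := hmin hmem

/-- **Mass control (RH-free).** With anchors as in `exists_anchor_lower_bound`: a nonnegative atom sum
with frequencies in `(0, θ]` that is within `ε ≤ 1` of `s/2` on a `δ`-dense `P ⊆ [1, 3]`, `δ ≤ κ/16`,
has total weight `Σ_k W_k ≤ 8/κ`. [folklore] -/
theorem sum_weights_le_of_nearMiss {θ κ x₁ ε δ : ℝ} (hκ : 0 < κ) (hx₁2 : 2 ≤ x₁) (hx₁3 : x₁ ≤ 3)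
    (hanchor : ∀ τ : ℝ, 0 < τ → τ ≤ θ →
      κ ≤ (1 - Real.cos (τ * 2)) / τ ^ 2 + (1 - Real.cos (τ * x₁)) / τ ^ 2)
    (hε : ε ≤ 1) (hδ : δ ≤ κ / 16) {K : ℕ} (τ W : Fin K → ℝ) (P : Finset ℝ)
    (hτW : ∀ k, 0 < τ k ∧ τ k ≤ θ ∧ 0 ≤ W k) (hP : ∀ p ∈ P, 1 ≤ p ∧ p ≤ 3)
    (hdense : ∀ x : ℝ, 1 ≤ x → x ≤ 3 → ∃ p ∈ P, |x - p| ≤ δ)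
    (hmiss : ∀ p ∈ P, |(∑ k, W k * (1 - Real.cos (τ k * p)) / (τ k) ^ 2) - p / 2| < ε) :
    ∑ k, W k ≤ 8 / κ := by
  set Φ : ℝ → ℝ := fun s => ∑ k, W k * (1 - Real.cos (τ k * s)) / (τ k) ^ 2 with hΦ
  have hτne : ∀ k, τ k ≠ 0 := fun k => (hτW k).1.ne'
  have hW : ∀ k, 0 ≤ W k := fun k => (hτW k).2.2
  have hSW : 0 ≤ ∑ k, W k := sum_nonneg fun k _ => hW k
  obtain ⟨p₀, hp₀P, hp₀⟩ := hdense 2 (by norm_num) (by norm_num)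
  obtain ⟨p₁, hp₁P, hp₁⟩ := hdense x₁ (by linarith) hx₁3
  -- values at the sample points
  have hv0 : Φ p₀ ≤ 5 / 2 := by
    have h1 := hmiss p₀ hp₀P
    have h2 := (hP p₀ hp₀P).2
    have h3 := (abs_lt.mp h1).2
    show (∑ k, W k * (1 - Real.cos (τ k * p₀)) / (τ k) ^ 2) ≤ 5 / 2
    linarith
  have hv1 : Φ p₁ ≤ 5 / 2 := by
    have h1 := hmiss p₁ hp₁P
    have h2 := (hP p₁ hp₁P).2
    have h3 := (abs_lt.mp h1).2
    show (∑ k, W k * (1 - Real.cos (τ k * p₁)) / (τ k) ^ 2) ≤ 5 / 2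
    linarith
  -- equicontinuity moves the samples to the anchors
  have hB0 : |(2 : ℝ)| ≤ 3 := by norm_num
  have hBp : ∀ p ∈ P, |p| ≤ 3 := fun p hp => by
    rw [abs_of_nonneg (by linarith [(hP p hp).1])]; exact (hP p hp).2
  have hBx : |x₁| ≤ 3 := by rw [abs_of_nonneg (by linarith)]; exact hx₁3
  have he0 : |Φ 2 - Φ p₀| ≤ 3 * (∑ k, W k) * |2 - p₀| :=
    abs_cosAtomSum_sub_le τ W hτne hW hB0 (hBp p₀ hp₀P)
  have he1 : |Φ x₁ - Φ p₁| ≤ 3 * (∑ k, W k) * |x₁ - p₁| :=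
    abs_cosAtomSum_sub_le τ W hτne hW hBx (hBp p₁ hp₁P)
  have hδ0 : 0 ≤ δ := le_trans (abs_nonneg _) hp₀
  have he0' : Φ 2 ≤ Φ p₀ + 3 * (∑ k, W k) * δ := by
    have := (abs_le.mp he0).2
    have h3 : 3 * (∑ k, W k) * |2 - p₀| ≤ 3 * (∑ k, W k) * δ :=
      mul_le_mul_of_nonneg_left hp₀ (by positivity)
    linarith
  have he1' : Φ x₁ ≤ Φ p₁ + 3 * (∑ k, W k) * δ := by
    have := (abs_le.mp he1).2
    have h3 : 3 * (∑ k, W k) * |x₁ - p₁| ≤ 3 * (∑ k, W k) * δ :=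
      mul_le_mul_of_nonneg_left hp₁ (by positivity)
    linarith
  -- the anchors see all the mass
  have hanch : κ * ∑ k, W k ≤ Φ 2 + Φ x₁ := by
    have e : Φ 2 + Φ x₁
        = ∑ k, W k * ((1 - Real.cos (τ k * 2)) / (τ k) ^ 2 + (1 - Real.cos (τ k * x₁)) / (τ k) ^ 2) := by
      show (∑ k, W k * (1 - Real.cos (τ k * 2)) / (τ k) ^ 2)
          + (∑ k, W k * (1 - Real.cos (τ k * x₁)) / (τ k) ^ 2) = _
      rw [← sum_add_distrib]
      refine sum_congr rfl fun k _ => ?_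
      ring
    rw [e, mul_sum]
    refine sum_le_sum fun k _ => ?_
    rw [mul_comm κ]
    exact mul_le_mul_of_nonneg_left (hanchor (τ k) (hτW k).1 (hτW k).2.1) (hW k)
  -- combine
  have hmain : κ * ∑ k, W k ≤ 5 + 6 * (∑ k, W k) * δ := by linarith
  have h6 : 6 * (∑ k, W k) * δ ≤ 6 * (∑ k, W k) * (κ / 16) :=
    mul_le_mul_of_nonneg_left hδ (by positivity)
  rw [le_div_iff₀ hκ]
  nlinarith

/-- **The exact second difference (RH-free).** For `τ_k ≠ 0` and `h ≠ 0`: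
`Φ(s+h) − 2Φ(s) + Φ(s−h) = h²·Σ_k W_k·(2(1 − cos(τ_k h))/(τ_k h)²)·cos(τ_k s)`; the linear target `s/2`
has second difference `0`. [folklore] -/
theorem cosAtomSum_second_diff {K : ℕ} (τ W : Fin K → ℝ) (hτ : ∀ k, τ k ≠ 0) {h : ℝ} (hh : h ≠ 0)
    (s : ℝ) :
    (∑ k, W k * (1 - Real.cos (τ k * (s + h))) / (τ k) ^ 2)
      - 2 * (∑ k, W k * (1 - Real.cos (τ k * s)) / (τ k) ^ 2)
      + (∑ k, W k * (1 - Real.cos (τ k * (s - h))) / (τ k) ^ 2)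
    = h ^ 2 * ∑ k, (W k * (2 * (1 - Real.cos (τ k * h)) / (τ k * h) ^ 2)) * Real.cos (τ k * s) := by
  rw [mul_sum, mul_sum, ← sum_sub_distrib, ← sum_add_distrib]
  refine sum_congr rfl fun k _ => ?_
  have hτk := hτ k
  rw [show τ k * (s + h) = τ k * s + τ k * h by ring, show τ k * (s - h) = τ k * s - τ k * h by ring,
    Real.cos_add, Real.cos_sub]
  field_simp
  ring

/-- `3/4 ≤ 2(1 − cos x)/x²` for `0 < x ≤ 1` (from `|cos x − (1 − x²/2)| ≤ (5/96)x⁴`). [folklore] -/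
theorem three_quarters_le_sincSq {x : ℝ} (hx0 : 0 < x) (hx1 : x ≤ 1) :
    3 / 4 ≤ 2 * (1 - Real.cos x) / x ^ 2 := by
  have h := Real.cos_bound (x := x) (by rw [abs_of_pos hx0]; exact hx1)
  rw [abs_of_pos hx0] at h
  have h1 := (abs_le.mp h).2
  have hx2 : x ^ 2 ≤ 1 := by nlinarith
  have hx4 : x ^ 4 ≤ x ^ 2 := by
    rw [show x ^ 4 = x ^ 2 * x ^ 2 by ring]
    exact mul_le_of_le_one_right (sq_nonneg x) hx2
  rw [le_div_iff₀ (by positivity)]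
  nlinarith

/-- `2(1 − cos x)/x² ≤ 1` for `x ≠ 0`. [folklore] -/
theorem sincSq_le_one {x : ℝ} (hx : x ≠ 0) : 2 * (1 - Real.cos x) / x ^ 2 ≤ 1 := by
  rw [div_le_one (by positivity)]
  have := Real.one_sub_sq_div_two_le_cos (x := x)
  linarith

/-- Lower mass bound: if `|Φ(1) − 1/2| ≤ t` then `1 − 2t ≤ Σ_k W_k` (`Φ(1) ≤ ½ Σ W`). [folklore] -/
theorem one_sub_le_sum_weights {K : ℕ} (τ W : Fin K → ℝ) (hW : ∀ k, 0 ≤ W k) {t : ℝ}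
    (h1 : |(∑ k, W k * (1 - Real.cos (τ k * 1)) / (τ k) ^ 2) - 1 / 2| ≤ t) :
    1 - 2 * t ≤ ∑ k, W k := by
  have h2 := cosAtomSum_le τ W hW 1
  have h3 := (abs_le.mp h1).1
  linarith

end Summit.RiemannHypothesis.RiemannHypothesis.Theorems.IntegerScrew.Manifest

end
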